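import Summits.AnomalousDissipation.AnomalousDissipation.Theorems.SolenoidalFractalHomogenisationLagrangianStepWEvenCertSlotsA
import HarnessLib

/-!
# K1L_D IS-half · E1-CERT v2 port, part 4/5: the face-diagonal class {110} and the class dispatch `slot_upper`/`slot_lower`

Summits-side PORT (prover seat `ad-sawtooth-k1loc-p1` g12; tenure E1-LAND 2026-08-29T00:31:55Z) of planner ad-ideate-p5 g12's certificate spine
`Cruxes/LagrangianRenormalisationStep/Lines/onelevel_W_evenSlack_cert.lean` v2 (commit 88965dfa39cf; the mathematics, the numerics `evencert.py` / kit j321011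
and the custody `HOME/ad-ideate-p5/k1l-even-cert/` are p5's) for the IS-half obligation `stub_W_evenSlackB : ∃ a > 0, WCrossing.EvenSlackWindowB a WCrossing.ρB`
of K1L_D `stub_cellLawV0_IS` (stmt-AnomalousDissipation-27980).  The port states everything over the LANDED `WCrossing` definitions
(`…LagrangianStepWCrossing`, prover ad-k1loc-p3 g7) instead of the spine's §W copies and wires the spine's three analytic stubs to landed theorems
(`stub_oddEven ↦ oddEven_qsResp` p681750, `stub_N110U/L ↦ encl_N110U/L` p682297, point enclosures `↦ encl_N1xx` p681405); texts otherwise VERBATIM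
(namespace `…LagrangianStep.WEvenCert`).  NOT a proof of `stub_cellLawV0_IS`, of the crux K1L_D, of Onsager's conjecture or of anomalous dissipation;
rung leaf F-D1.A0.

Part 4: §3.7 `slot_upper_110`/`slot_lower_110` (per-eigenvalue step in the explicit frame `z ⊥ m`, `z × m`), §3.8 slot table facts and `slot_upper`/`slot_lower`.
-/

set_option linter.dupNamespace false

noncomputable section

namespace Summit.AnomalousDissipation.AnomalousDissipation.Theorems.SolenoidalFractalHomogenisation.LagrangianStep.WEvenCert

open Summit.AnomalousDissipation.AnomalousDissipation.Theorems
open Summit.AnomalousDissipation.AnomalousDissipation.Theorems.SolenoidalFractalHomogenisation.LagrangianStep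
open Summit.AnomalousDissipation.AnomalousDissipation.Theorems.SolenoidalFractalHomogenisation.LagrangianStep.WCrossing
open Literature.Analysis Literature.Analysis.FluidPDE Literature.Analysis.FunctionSpaces
open Literature.Algebra.EuclideanLattices (norm_sq_fin_three)
open Set Real

/-! ### §3.7 Face-diagonal class {110}: per-eigenvalue step with the explicit frame `z` (axis ⊥ m), `dv = z × m` -/


/-- `sI` (E1-CERT v2 spine §3.7–§3.8, p5 g12). -/
theorem sI (c : ℝ) (M : Matrix (Fin 3) (Fin 3) ℝ) (w : Fin 3 → ℝ) :
    ∑ i, ∑ j, w i * (c • M) i j * w j = c * ∑ i, ∑ j, w i * M i j * w j := by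
  simp only [Matrix.smul_apply, smul_eq_mul, Finset.mul_sum]
  exact Finset.sum_congr rfl fun i _ => Finset.sum_congr rfl fun j _ => by ring

/-- `dot_eq_three` (E1-CERT v2 spine §3.7–§3.8, p5 g12). -/
theorem dot_eq_three (u w : Fin 3 → ℝ) : ∑ i, u i * w i = u 0 * w 0 + u 1 * w 1 + u 2 * w 2 := by
  simp [Fin.sum_univ_three]

/-- the `u`-range of the {110} upper step: `γ ∈ [slo/λ, λ]` ⟹ `1/(λγ) ∈ [0.83, 1.002]`. -/
theorem urange {lam γ : ℝ} (hlam : lam ∈ Icc lam0 LamW) (h1 : sloC / lam ≤ γ) (h2 : γ ≤ lam * 1) :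
    (83 / 100 : ℝ) ≤ 1 / (lam * γ) ∧ 1 / (lam * γ) ≤ 1002 / 1000 := by
  have hl0 : 0 < lam := lt_of_lt_of_le lam0_pos hlam.1
  have hslo : (0:ℝ) < sloC := by unfold sloC; norm_num
  have hγ0 : 0 < γ := lt_of_lt_of_le (div_pos hslo hl0) h1
  have hlg : sloC ≤ lam * γ := by rwa [div_le_iff₀ hl0, mul_comm] at h1
  have hlg2 : lam * γ ≤ LamW * LamW :=
    le_trans (mul_le_mul_of_nonneg_left h2 hl0.le) (by rw [mul_one]; exact mul_le_mul hlam.2 hlam.2 hl0.le (by unfold LamW; norm_num))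
  have hn1 : (83 / 100 : ℝ) * (LamW * LamW) ≤ 1 := by unfold LamW; norm_num
  have hn2 : (1 : ℝ) ≤ 1002 / 1000 * sloC := by unfold sloC; norm_num
  constructor
  · rw [le_div_iff₀ (mul_pos hl0 hγ0)]; nlinarith
  · rw [div_le_iff₀ (mul_pos hl0 hγ0)]; nlinarith

/-- the `x`-range of the {110} lower step: `γ ∈ [slo/λ, λ]` ⟹ `γ/λ ∈ [0.83, 1]`. -/
theorem xrange {lam γ : ℝ} (hlam : lam ∈ Icc lam0 LamW) (h1 : sloC / lam ≤ γ) (h2 : γ ≤ lam * 1) :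
    (83 / 100 : ℝ) ≤ γ / lam ∧ γ / lam ≤ 1 := by
  have hl0 : 0 < lam := lt_of_lt_of_le lam0_pos hlam.1
  have hll : lam * lam ≤ LamW * LamW := mul_le_mul hlam.2 hlam.2 hl0.le (by unfold LamW; norm_num)
  have hnum : (83 / 100 : ℝ) * (LamW * LamW) ≤ sloC := by unfold LamW sloC; norm_num
  constructor
  · rw [le_div_iff₀ hl0]
    rw [div_le_iff₀ hl0] at h1
    have h3 : (83 / 100 : ℝ) * lam * lam ≤ γ * lam := by nlinarith
    exact le_of_mul_le_mul_right h3 hl0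
  · rw [div_le_one hl0]; linarith

/-- UPPER, class {110}. -/
theorem slot_upper_110 {lam τ : ℝ} (hlam : lam ∈ Icc lam0 LamW) (hτ : τ ∈ Icc 0 τ0c) {S : T4}
    (hI : InInterval Sc lam S) (hO : OddSectorial S τ) (j : Fin 26)
    (hM : Mq (slots j) = 2) (hT : Tj j = T110)
    (hframe : ∀ u w : Fin 3 → ℝ, u 0 * w 0 + u 1 * w 1 + u 2 * w 2
      = zd (slots j) u * zd (slots j) w + dd (slots j) u * dd (slots j) w / 2 + mdot (slots j) u * mdot (slots j) w / 2)
    (hdm : ∀ w : Fin 3 → ℝ, ∀ s : ℝ, dd (slots j) (fun c => w c - ((slots j).m c : ℝ) * s) = dd (slots j) w)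
    (hzP : ∀ w : Fin 3 → ℝ, ∀ s : ℝ, zd (slots j) (fun c => w c - ((slots j).m c : ℝ) * s) = zd (slots j) w)
    (hI1 : ∀ w : Fin 3 → ℝ, I1m (slots j) w = nsq w - zd (slots j) w ^ 2)
    (hZf : ∀ w : Fin 3 → ℝ, Zf (slots j) w = zd (slots j) w ^ 2) (p : Fin 3 → ℝ) :
    ∑ i, ∑ i', p i * slotQ cubatureWord MB S j i i' * p i'
      ≤ lam / lam0 * (UA * (∑ i, p i ^ 2 - (∑ i, p i * nj j i) ^ 2)
          + UB * (Zf (slots j) p + ((∑ i, p i ^ 2 - (∑ i, p i * nj j i) ^ 2) - Zf (slots j) p) / βd)) := by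
  have hn := hn_j j
  have hl1 : 1 ≤ lam := le_trans (by unfold lam0; norm_num) hlam.1
  have hl0 : 0 < lam := by linarith
  have hslo : (0:ℝ) < sloC := by unfold sloC; norm_num
  have hβd : (0:ℝ) < βd := by rw [βd_eq_sloC]; exact hslo
  have hodd := (abs_sub_le_iff.1 (slot_oddEven hlam hτ hI hO j p)).1
  have hP0 : 0 ≤ ∑ i, p i ^ 2 - (∑ i, p i * nj j i) ^ 2 := by rw [← sum_sq_projPerp_mulVec hn]; positivity
  -- coordinates
  have hPc : ∀ w : Fin 3 → ℝ, ∀ c, (projPerp (nj j)).mulVec w c = w c - ((slots j).m c : ℝ) * (mdot (slots j) w / 2) := by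
    intro w c; rw [projPerp_nj_apply, hM]; ring
  have hPfun : ∀ w : Fin 3 → ℝ, (projPerp (nj j)).mulVec w = fun c => w c - ((slots j).m c : ℝ) * (mdot (slots j) w / 2) :=
    fun w => funext (hPc w)
  have hmm : ((slots j).m 0 : ℝ) ^ 2 + ((slots j).m 1 : ℝ) ^ 2 + ((slots j).m 2 : ℝ) ^ 2 = 2 := by rw [← hM]; rfl
  have hmdP : ∀ w, mdot (slots j) ((projPerp (nj j)).mulVec w) = 0 := by
    intro w; rw [hPfun]; unfold mdot; simp only
    linear_combination (-(((slots j).m 0 : ℝ) * w 0 + (slots j).m 1 * w 1 + (slots j).m 2 * w 2) / 2) * hmm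
  have hzdP : ∀ w, zd (slots j) ((projPerp (nj j)).mulVec w) = zd (slots j) w := fun w => by rw [hPfun]; exact hzP w _
  have hddP : ∀ w, dd (slots j) ((projPerp (nj j)).mulVec w) = dd (slots j) w := fun w => by rw [hPfun]; exact hdm w _
  have hnsq : ∀ w : Fin 3 → ℝ, nsq w = zd (slots j) w ^ 2 + dd (slots j) w ^ 2 / 2 + mdot (slots j) w ^ 2 / 2 := by
    intro w; have h := hframe w w; unfold nsq; linear_combination h
  have hnsqP : ∀ w, nsq ((projPerp (nj j)).mulVec w) = zd (slots j) w ^ 2 + dd (slots j) w ^ 2 / 2 := by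
    intro w; rw [hnsq, hmdP, hzdP, hddP]; ring
  -- the reference form R(w) = wᵀ B̂(Sc,n) w = zd² + βd dd²/2 + mdot²/2
  have hR : ∀ w : Fin 3 → ℝ, ∑ i, ∑ i', w i * regBlock Sc (nj j) i i' * w i'
      = zd (slots j) w ^ 2 + βd * dd (slots j) w ^ 2 / 2 + mdot (slots j) w ^ 2 / 2 := by
    intro w
    rw [regBlock_quad hn, symb_Sc_nj, hI1, hnsqP, hzdP, dot_nj, div_pow, norm_sq_m, hM, βd]
    ring
  -- |P p|² in coordinates
  have hPsq : ∑ i, p i ^ 2 - (∑ i, p i * nj j i) ^ 2 = zd (slots j) p ^ 2 + dd (slots j) p ^ 2 / 2 := by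
    rw [dot_nj_sq, hM, nsq_eq, hnsq p]; ring
  set v := (projPerp (nj j)).mulVec p with hv
  have hvsq : ∑ i, v i ^ 2 = ∑ i, p i ^ 2 - (∑ i, p i * nj j i) ^ 2 := sum_sq_projPerp_mulVec hn p
  -- symmetric part via the per-eigenvalue step
  have hBs : (regBlock (symS S) (nj j)).IsSymm := regBlock_isSymm (oddSmall_symS S) hn
  have hIs := inInterval_symS hI
  have hperpw : ∀ w : Fin 3 → ℝ, ∑ i, nj j i * w i = 0 → ∑ i, w i * nj j i = 0 :=
    fun w hw => by rw [← hw]; exact Finset.sum_congr rfl fun i _ => mul_comm _ _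
  have ha : ∀ w : Fin 3 → ℝ, sloC / lam * ∑ i, w i ^ 2 ≤ ∑ i, ∑ j', w i * regBlock (symS S) (nj j) i j' * w j' :=
    fun w => regBlock_floor_of_inInterval hn hl1 (by rw [div_le_one hl0]; exact le_trans (by unfold sloC; norm_num) hl1)
      (fun w hw => by have h := (nearIso_Sc (nj j) w (hperpw w hw)).1; rw [hn, one_mul] at h; exact h) hIs w
  have hc : ∀ w : Fin 3 → ℝ, ∑ i, ∑ j', w i * regBlock (symS S) (nj j) i j' * w j' ≤ lam * 1 * ∑ i, w i ^ 2 :=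
    fun w => regBlock_ceiling_of_inInterval hn hl1 (by linarith)
      (fun w hw => by have h := (nearIso_Sc (nj j) w (hperpw w hw)).2; rw [hn, one_mul] at h; exact h) hIs w
  have hRle : ∀ w : Fin 3 → ℝ, 1 / lam * ∑ i, ∑ i', w i * regBlock Sc (nj j) i i' * w i'
      ≤ ∑ i, ∑ j', w i * regBlock (symS S) (nj j) i j' * w j' := by
    intro w; have h := regBlock_loewner_lower_of_inInterval hn hl1 hIs w; rwa [sI] at h
  have hT0 : 0 < T110 := by rw [← hT]; exact Tj_pos j
  have hUB : (0:ℝ) ≤ UB := by unfold UB; norm_num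
  set Y := zd (slots j) p ^ 2 + dd (slots j) p ^ 2 / (2 * βd) with hY
  have hYineq : ∀ w : Fin 3 → ℝ, UB * (2 * lam * ∑ i, v i * w i - ∑ i, ∑ i', w i * regBlock Sc (nj j) i i' * w i')
      ≤ lam ^ 2 * UB * Y := by
    intro w
    rw [dot_eq_three, hframe v w, hmdP p, hzdP p, hddP p, hR w]
    have key : lam ^ 2 * Y + (zd (slots j) w ^ 2 + βd * dd (slots j) w ^ 2 / 2 + mdot (slots j) w ^ 2 / 2)
        - 2 * lam * (zd (slots j) p * zd (slots j) w + dd (slots j) p * dd (slots j) w / 2 + 0 * mdot (slots j) w / 2)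
        = (zd (slots j) w - lam * zd (slots j) p) ^ 2 + βd / 2 * (dd (slots j) w - lam * dd (slots j) p / βd) ^ 2
          + mdot (slots j) w ^ 2 / 2 := by
      rw [hY]; field_simp; ring
    have hsos : 0 ≤ (zd (slots j) w - lam * zd (slots j) p) ^ 2 + βd / 2 * (dd (slots j) w - lam * dd (slots j) p / βd) ^ 2
          + mdot (slots j) w ^ 2 / 2 := by positivity
    nlinarith [key, hsos, hUB]
  have hgen := form_qsResp_le_of_eig hBs (fun w => ∑ i, ∑ i', w i * regBlock Sc (nj j) i i' * w i') v hlam.1 (div_pos hslo hl0)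
    ha hc hRle hT0 hUB (fun γ h1 h2 => urange hlam h1 h2) stub_N110U hYineq
  -- assemble
  have hsymform : ∑ i, ∑ i', p i * slotQ cubatureWord MB (symS S) j i i' * p i'
      = ∑ i, ∑ i', v i * qsResp (1 / 2) T110 (regBlock (symS S) (nj j)) i i' * v i' := by
    rw [slotQ_eq, sum_sum_mul_qsResp_regBlock_projPerp hn, hT]
  rw [hsymform] at hodd
  rw [hvsq] at hgen
  have hYeq : Zf (slots j) p + ((∑ i, p i ^ 2 - (∑ i, p i * nj j i) ^ 2) - Zf (slots j) p) / βd = Y := by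
    rw [hZf, hPsq, hY]; field_simp; ring
  rw [hYeq]
  have hll : 1 ≤ lam / lam0 := by rw [le_div_iff₀ lam0_pos, one_mul]; exact hlam.1
  have hE : (0:ℝ) ≤ ellBar := by unfold ellBar; norm_num
  have h2 : ellBar * (∑ i, p i ^ 2 - (∑ i, p i * nj j i) ^ 2) ≤ lam / lam0 * ellBar * (∑ i, p i ^ 2 - (∑ i, p i * nj j i) ^ 2) := by
    apply mul_le_mul_of_nonneg_right _ hP0; nlinarith
  unfold UA
  nlinarith [hodd, hgen, h2]

/-- LOWER, class {110}. -/
theorem slot_lower_110 {lam τ : ℝ} (hlam : lam ∈ Icc lam0 LamW) (hτ : τ ∈ Icc 0 τ0c) {S : T4}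
    (hI : InInterval Sc lam S) (hO : OddSectorial S τ) (j : Fin 26)
    (hM : Mq (slots j) = 2) (hT : Tj j = T110)
    (hzP : ∀ w : Fin 3 → ℝ, ∀ s : ℝ, zd (slots j) (fun c => w c - ((slots j).m c : ℝ) * s) = zd (slots j) w)
    (hI1 : ∀ w : Fin 3 → ℝ, I1m (slots j) w = nsq w - zd (slots j) w ^ 2)
    (hZf : ∀ w : Fin 3 → ℝ, Zf (slots j) w = zd (slots j) w ^ 2) (p : Fin 3 → ℝ) :
    1 / lam * (LA * (∑ i, p i ^ 2 - (∑ i, p i * nj j i) ^ 2)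
        + LB * (βd * (∑ i, p i ^ 2 - (∑ i, p i * nj j i) ^ 2) + (1 - βd) * Zf (slots j) p))
      ≤ ∑ i, ∑ i', p i * slotQ cubatureWord MB S j i i' * p i' := by
  have hn := hn_j j
  have hl1 : 1 ≤ lam := le_trans (by unfold lam0; norm_num) hlam.1
  have hl0 : 0 < lam := by linarith
  have hslo : (0:ℝ) < sloC := by unfold sloC; norm_num
  have hodd := (abs_sub_le_iff.1 (slot_oddEven hlam hτ hI hO j p)).2
  have hP0 : 0 ≤ ∑ i, p i ^ 2 - (∑ i, p i * nj j i) ^ 2 := by rw [← sum_sq_projPerp_mulVec hn]; positivity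
  have hPc : ∀ w : Fin 3 → ℝ, ∀ c, (projPerp (nj j)).mulVec w c = w c - ((slots j).m c : ℝ) * (mdot (slots j) w / 2) := by
    intro w c; rw [projPerp_nj_apply, hM]; ring
  have hPfun : ∀ w : Fin 3 → ℝ, (projPerp (nj j)).mulVec w = fun c => w c - ((slots j).m c : ℝ) * (mdot (slots j) w / 2) :=
    fun w => funext (hPc w)
  have hzdP : ∀ w, zd (slots j) ((projPerp (nj j)).mulVec w) = zd (slots j) w := fun w => by rw [hPfun]; exact hzP w _
  set v := (projPerp (nj j)).mulVec p with hv
  have hvsq : ∑ i, v i ^ 2 = ∑ i, p i ^ 2 - (∑ i, p i * nj j i) ^ 2 := sum_sq_projPerp_mulVec hn p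
  have hvperp : ∑ i, nj j i * v i = 0 := sum_mul_projPerp_mulVec hn p
  have hvperp' : ∑ i, v i * nj j i = 0 := sum_projPerp_mulVec_mul hn p
  -- R v = symb Sc n v = βd |v|² + (1 − βd) Zf p
  have hRv : Torus.symb Sc (nj j) v = βd * (∑ i, p i ^ 2 - (∑ i, p i * nj j i) ^ 2) + (1 - βd) * Zf (slots j) p := by
    rw [symb_Sc_nj, hI1, ← nsq_eq, hvsq, hzdP, hZf, hM, βd]; ring
  have hBs : (regBlock (symS S) (nj j)).IsSymm := regBlock_isSymm (oddSmall_symS S) hn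
  have hIs := inInterval_symS hI
  have hperpw : ∀ w : Fin 3 → ℝ, ∑ i, nj j i * w i = 0 → ∑ i, w i * nj j i = 0 :=
    fun w hw => by rw [← hw]; exact Finset.sum_congr rfl fun i _ => mul_comm _ _
  have ha : ∀ w : Fin 3 → ℝ, sloC / lam * ∑ i, w i ^ 2 ≤ ∑ i, ∑ j', w i * regBlock (symS S) (nj j) i j' * w j' :=
    fun w => regBlock_floor_of_inInterval hn hl1 (by rw [div_le_one hl0]; exact le_trans (by unfold sloC; norm_num) hl1)
      (fun w hw => by have h := (nearIso_Sc (nj j) w (hperpw w hw)).1; rw [hn, one_mul] at h; exact h) hIs w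
  have hc : ∀ w : Fin 3 → ℝ, ∑ i, ∑ j', w i * regBlock (symS S) (nj j) i j' * w j' ≤ lam * 1 * ∑ i, w i ^ 2 :=
    fun w => regBlock_ceiling_of_inInterval hn hl1 (by linarith)
      (fun w hw => by have h := (nearIso_Sc (nj j) w (hperpw w hw)).2; rw [hn, one_mul] at h; exact h) hIs w
  -- vᵀ B̂s v = symb (symS S) n v = symb S n v ≤ λ symb Sc n v
  have hRvle : ∑ i, ∑ i', v i * regBlock (symS S) (nj j) i i' * v i' ≤ lam * Torus.symb Sc (nj j) v := by
    rw [sum_sum_mul_regBlock_mul_of_perp hvperp, symb_symS]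
    have h := hI.2 (nj j) v hvperp'
    rwa [Torus.symb_smul] at h
  have hT0 : 0 < T110 := by rw [← hT]; exact Tj_pos j
  have hLB : LB ≤ 0 := by unfold LB; norm_num
  have hgen := le_form_qsResp_of_eig hBs (fun w => Torus.symb Sc (nj j) w) v hlam.1 (div_pos hslo hl0)
    ha hc hRvle hT0 hLB (fun γ h1 h2 => xrange hlam h1 h2) stub_N110L
  have hsymform : ∑ i, ∑ i', p i * slotQ cubatureWord MB (symS S) j i i' * p i'
      = ∑ i, ∑ i', v i * qsResp (1 / 2) T110 (regBlock (symS S) (nj j)) i i' * v i' := by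
    rw [slotQ_eq, sum_sum_mul_qsResp_regBlock_projPerp hn, hT]
  rw [hsymform] at hodd
  rw [hvsq, hRv] at hgen
  have hE : (0:ℝ) ≤ ellBar := by unfold ellBar; norm_num
  have h2 : ellBar * (∑ i, p i ^ 2 - (∑ i, p i * nj j i) ^ 2) ≤ 1 / lam * (LamW * ellBar) * (∑ i, p i ^ 2 - (∑ i, p i * nj j i) ^ 2) := by
    apply mul_le_mul_of_nonneg_right _ hP0
    rw [one_div, ← div_eq_inv_mul, le_div_iff₀ hl0]
    nlinarith [hlam.2]
  have hsplit : 1 / lam * (LA * (∑ i, p i ^ 2 - (∑ i, p i * nj j i) ^ 2)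
        + LB * (βd * (∑ i, p i ^ 2 - (∑ i, p i * nj j i) ^ 2) + (1 - βd) * Zf (slots j) p))
      = 1 / lam * (LAp * (∑ i, p i ^ 2 - (∑ i, p i * nj j i) ^ 2)
        + LB * (βd * (∑ i, p i ^ 2 - (∑ i, p i * nj j i) ^ 2) + (1 - βd) * Zf (slots j) p))
        - 1 / lam * (LamW * ellBar) * (∑ i, p i ^ 2 - (∑ i, p i * nj j i) ^ 2) := by
    unfold LA; ring
  rw [hsplit]
  linarith [hodd, hgen, h2]


/-! ### §3.8 Per-slot data of the 26-slot word and the class dispatch -/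

/-- `(z × m)·m = 0`: the `dv`-coordinate is blind to shifts along `m` (a polynomial identity). -/
theorem dd_shift (d : SlotData) (w : Fin 3 → ℝ) (s : ℝ) : dd d (fun c => w c - (d.m c : ℝ) * s) = dd d w := by
  unfold dd; ring

/-- `slot_class` (E1-CERT v2 spine §3.7–§3.8, p5 g12). -/
theorem slot_class (j : Fin 26) : j.val < 6 ∨ (6 ≤ j.val ∧ j.val < 18) ∨ 18 ≤ j.val := by omega

/-- axes (slots 0–5): `|m|² = 1`, `T = T100`, `Σ m_c² w_c² = (m·w)²`. -/
theorem facts100 (j : Fin 26) (hj : j.val < 6) :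
    Mq (slots j) = 1 ∧ Tj j = T100 ∧ ∀ w : Fin 3 → ℝ, I1m (slots j) w = mdot (slots j) w ^ 2 := by
  fin_cases j <;> norm_num at hj <;> refine ⟨?_, ?_, fun w => ?_⟩ <;>
    simp [slots, Mq, Tj, T100, MB, I1m, mdot, Matrix.cons_val_zero, Matrix.cons_val_one, Matrix.cons_val_two,
      Matrix.head_cons, Matrix.tail_cons]

/-- body diagonals (slots 18–25): `|m|² = 3`, `T = T111`, `Σ m_c² w_c² = |w|²`. -/
theorem facts111 (j : Fin 26) (hj : 18 ≤ j.val) :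
    Mq (slots j) = 3 ∧ Tj j = T111 ∧ ∀ w : Fin 3 → ℝ, I1m (slots j) w = nsq w := by
  fin_cases j <;> norm_num at hj <;> refine ⟨?_, ?_, fun w => ?_⟩ <;>
    simp [slots, Mq, Tj, T111, MB, I1m, nsq, Matrix.cons_val_zero, Matrix.cons_val_one, Matrix.cons_val_two,
      Matrix.head_cons, Matrix.tail_cons] <;> ring

/-- face diagonals (slots 6–17): `|m|² = 2`, `T = T110`, the polar frame identity, `z ⊥ m`-shift invariance,
`Σ m_c² w_c² = |w|² − (z·w)²`, `Zf = (z·w)²`. -/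
theorem facts110 (j : Fin 26) (hj : 6 ≤ j.val ∧ j.val < 18) :
    Mq (slots j) = 2 ∧ Tj j = T110 ∧
    (∀ u w : Fin 3 → ℝ, u 0 * w 0 + u 1 * w 1 + u 2 * w 2
      = zd (slots j) u * zd (slots j) w + dd (slots j) u * dd (slots j) w / 2 + mdot (slots j) u * mdot (slots j) w / 2) ∧
    (∀ w : Fin 3 → ℝ, ∀ s : ℝ, zd (slots j) (fun c => w c - ((slots j).m c : ℝ) * s) = zd (slots j) w) ∧
    (∀ w : Fin 3 → ℝ, I1m (slots j) w = nsq w - zd (slots j) w ^ 2) ∧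
    (∀ w : Fin 3 → ℝ, Zf (slots j) w = zd (slots j) w ^ 2) := by
  fin_cases j <;> norm_num at hj <;> refine ⟨?_, ?_, fun u w => ?_, fun w s => ?_, fun w => ?_, fun w => ?_⟩ <;>
    simp [slots, Mq, Tj, T110, MB, zv, zd, dd, mdot, I1m, Zf, nsq, Matrix.cons_val_zero, Matrix.cons_val_one,
      Matrix.cons_val_two, Matrix.head_cons, Matrix.tail_cons] <;> ring

/-- **Per-slot UPPER bound** (was `stub_slot_upper` in v1): `pᵀ Q_j(S) p ≤ (λ/λ₀)·uForm_j(p)` on the certificate window. -/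
theorem slot_upper {lam τ : ℝ} (hlam : lam ∈ Icc lam0 LamW) (hτ : τ ∈ Icc 0 τ0c) {S : T4}
    (hI : InInterval Sc lam S) (hO : OddSectorial S τ) (j : Fin 26) (p : Fin 3 → ℝ) :
    ∑ i, ∑ i', p i * slotQ cubatureWord MB S j i i' * p i' ≤ lam / lam0 * uForm (slots j) p := by
  rcases slot_class j with hj | hj | hj
  · obtain ⟨hM, hT, hI1⟩ := facts100 j hj
    have hwin : ∀ w : Fin 3 → ℝ, ∑ i, nj j i * w i = 0 → Torus.symb Sc (nj j) w = 1 * ∑ i, w i ^ 2 := by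
      intro w hw; rw [symb_Sc_nj, hI1, (perp_iff j w).1 hw, nsq_eq]; ring
    have h := slot_upper_scalar hlam hτ hI hO j one_pos le_rfl hwin (Up := U100p) (by rw [hT]; exact stub_N100U) p
    rw [perp_sq, hM] at h
    calc _ ≤ _ := h
      _ = lam / lam0 * uForm (slots j) p := by unfold uForm qLag qA1 U100; rw [hM]; ring
  · obtain ⟨hM, hT, hframe, hzP, hI1, hZf⟩ := facts110 j hj
    have h := slot_upper_110 hlam hτ hI hO j hM hT hframe (dd_shift (slots j)) hzP hI1 hZf p
    rw [perp_sq, hM] at h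
    have hβ : βd ≠ 0 := by rw [βd_eq_sloC]; unfold sloC; norm_num
    calc _ ≤ _ := h
      _ = lam / lam0 * uForm (slots j) p := by unfold uForm qLag qA2 qB2; rw [hM]; field_simp; ring
  · obtain ⟨hM, hT, hI1⟩ := facts111 j hj
    have hwin : ∀ w : Fin 3 → ℝ, ∑ i, nj j i * w i = 0 → Torus.symb Sc (nj j) w = β111 * ∑ i, w i ^ 2 := by
      intro w _; rw [symb_Sc_nj, hI1, nsq_eq, hM, β111]; ring
    have h := slot_upper_scalar hlam hτ hI hO j (α := β111) (by unfold β111 κc; norm_num) (by unfold β111 κc; norm_num) hwin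
      (Up := U111p) (by rw [hT]; exact stub_N111U) p
    rw [perp_sq, hM] at h
    calc _ ≤ _ := h
      _ = lam / lam0 * uForm (slots j) p := by unfold uForm qLag qA3 U111; rw [hM]; ring

/-- **Per-slot LOWER bound** (was `stub_slot_lower` in v1): `lForm_j(p)/λ ≤ pᵀ Q_j(S) p` on the certificate window. -/
theorem slot_lower {lam τ : ℝ} (hlam : lam ∈ Icc lam0 LamW) (hτ : τ ∈ Icc 0 τ0c) {S : T4}
    (hI : InInterval Sc lam S) (hO : OddSectorial S τ) (j : Fin 26) (p : Fin 3 → ℝ) :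
    lForm (slots j) p / lam ≤ ∑ i, ∑ i', p i * slotQ cubatureWord MB S j i i' * p i' := by
  rcases slot_class j with hj | hj | hj
  · obtain ⟨hM, hT, hI1⟩ := facts100 j hj
    have hwin : ∀ w : Fin 3 → ℝ, ∑ i, nj j i * w i = 0 → Torus.symb Sc (nj j) w = 1 * ∑ i, w i ^ 2 := by
      intro w hw; rw [symb_Sc_nj, hI1, (perp_iff j w).1 hw, nsq_eq]; ring
    have h := slot_lower_scalar hlam hτ hI hO j one_pos (by unfold lam0; norm_num) hwin (Lp := L100p) (by rw [hT]; exact stub_N100L) p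
    rw [perp_sq, hM] at h
    calc lForm (slots j) p / lam = _ := by unfold lForm qLag lA1 L100; rw [hM]; ring
      _ ≤ _ := h
  · obtain ⟨hM, hT, hframe, hzP, hI1, hZf⟩ := facts110 j hj
    have h := slot_lower_110 hlam hτ hI hO j hM hT hzP hI1 hZf p
    rw [perp_sq, hM] at h
    calc lForm (slots j) p / lam = _ := by unfold lForm qLag lA2 lB2; rw [hM]; ring
      _ ≤ _ := h
  · obtain ⟨hM, hT, hI1⟩ := facts111 j hj
    have hwin : ∀ w : Fin 3 → ℝ, ∑ i, nj j i * w i = 0 → Torus.symb Sc (nj j) w = β111 * ∑ i, w i ^ 2 := by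
      intro w _; rw [symb_Sc_nj, hI1, nsq_eq, hM, β111]; ring
    have h := slot_lower_scalar hlam hτ hI hO j (α := β111) (by unfold β111 κc; norm_num) (by unfold β111 κc lam0; norm_num) hwin
      (Lp := L111p) (by rw [hT]; exact stub_N111L) p
    rw [perp_sq, hM] at h
    calc lForm (slots j) p / lam = _ := by unfold lForm qLag lA3 L111; rw [hM]; ring
      _ ≤ _ := h




end Summit.AnomalousDissipation.AnomalousDissipation.Theorems.SolenoidalFractalHomogenisation.LagrangianStep.WEvenCert
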